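import Summits.CriticalPhenomena.PercolationContinuityZ3.Theorems.PercNearOneGluingNoHeavyPcintBSMXLaw
import HarnessLib

/-!
# PCINT lane, PHASE 6 (block renewal with reach-two pieces), step 3: uniform bounds for the partial Green sums

Cell `prim-pcint`, seat `prim-pcint-1` (gen 15); memo `run/shared/lean/prim/pcint/T-FIBRE-ROUTE.md` §PHASE 6.

The terms of the Green series of the pair offset chain are `u k i · Π_l H a₁ a₂ (2i) (δ l)` (…PcintBSMXGreen), with
`t ≥ 2` transverse coordinates.  By the dispersion bound of …PcintBSMXLaw (`H (2i) δ ² ≤ 1/((2i+1) 4a₁)`) and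
`0 ≤ H ≤ 1`, every term is at most `u k i / ((2i+1) 4a₁)` (**`BSMX.term_le`**).  Two RATIONAL tails follow:

* `k = 2` time axes (**`BSMX.tailBound_two`**): `u 2 i = C(2i,i)/4ⁱ` exactly (`BSMX.u_two_eq`), so
  `u 2 i - u 2 (i+1) = u 2 i / (2i+2)` and the tail beyond `N` telescopes to `u 2 N · (2N+2) / ((2N+1) 4a₁)`;
* `k ≥ 3` time axes (**`BSMX.tailBound_three`**): the balanced multinomial probability `B k q` of the tree
  (`OSM.B`, `OSM.u_mul_le_B`) satisfies `B (q+1) (q+2) ≤ B q (q+1)` for `k ≥ 3` (`BSMX.B_step1`, elementary), so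
  `u k i ≤ k B k q₀ (q₀+1) / (i+1)` for `i ≥ q₀ k` and the tail beyond `N ≥ q₀ k` is at most
  `k B k q₀ (q₀+1) / (8 a₁ N)` (telescoping `1/((i+1)(2i+1)) ≤ (1/i - 1/(i+1))/2`).

Tail bounds are packaged as `BSMX.TailBoundH` (finite sums `BSMX.G0H`, `BSMX.G1H` plus a constant, uniformly in the
horizon), the analogue of `BSM.TailBound`.
-/

noncomputable section

namespace Summit.CriticalPhenomena.PercolationContinuityZ3.Theorems.Pcint.BSMX

open Finset OSM BSM

variable {t k : ℕ}

/-! ### Products of the transverse factors -/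

/-- `Π_l H ≥ 0`. -/
theorem prod_H_nonneg {a₁ a₂ : ℝ} (h : Adm a₁ a₂) (n : ℕ) (δ : Fin t → ℤ) : 0 ≤ ∏ l, H a₁ a₂ n (δ l) :=
  prod_nonneg fun _ _ => H_nonneg h.a₁_nonneg h.nonneg h.two_le n _

/-- `Π_l H ≤ 1`. -/
theorem prod_H_le_one {a₁ a₂ : ℝ} (h : Adm a₁ a₂) (n : ℕ) (δ : Fin t → ℤ) : ∏ l, H a₁ a₂ n (δ l) ≤ 1 :=
  prod_le_one (fun _ _ => H_nonneg h.a₁_nonneg h.nonneg h.two_le n _) fun _ _ => H_le_one h.a₁_nonneg h.nonneg h.two_le n _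

/-- For `t ≥ 2` coordinates, `Π_l H n (δ l) ≤ H n (δ 0) · H n (δ 1)`. -/
theorem prod_H_le_two {a₁ a₂ : ℝ} (h : Adm a₁ a₂) (ht : 2 ≤ t) (n : ℕ) (δ : Fin t → ℤ) :
    ∏ l, H a₁ a₂ n (δ l) ≤ H a₁ a₂ n (δ ⟨0, by omega⟩) * H a₁ a₂ n (δ ⟨1, by omega⟩) := by
  set i₀ : Fin t := ⟨0, by omega⟩
  set i₁ : Fin t := ⟨1, by omega⟩
  have hne : i₀ ≠ i₁ := by intro h; have := congr_arg Fin.val h; simp [i₀, i₁] at this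
  have h0 := fun n l => H_nonneg h.a₁_nonneg h.nonneg h.two_le n (δ l)
  have h1 := fun n l => H_le_one h.a₁_nonneg h.nonneg h.two_le n (δ l)
  rw [← Finset.prod_mul_prod_compl ({i₀, i₁} : Finset (Fin t)) (fun l => H a₁ a₂ n (δ l)), prod_pair hne]
  calc H a₁ a₂ n (δ i₀) * H a₁ a₂ n (δ i₁) * ∏ l ∈ ({i₀, i₁} : Finset (Fin t))ᶜ, H a₁ a₂ n (δ l)
      ≤ H a₁ a₂ n (δ i₀) * H a₁ a₂ n (δ i₁) * 1 :=
        mul_le_mul_of_nonneg_left (prod_le_one (fun l _ => h0 n l) fun l _ => h1 n l) (mul_nonneg (h0 n i₀) (h0 n i₁))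
    _ = _ := mul_one _

/-- **The transverse factor bound**: `Π_l H (2i) (δ l) ≤ 1 / ((2i+1) 4a₁)` for `t ≥ 2`. -/
theorem prod_H_le {a₁ a₂ : ℝ} (h : Adm a₁ a₂) (ht : 2 ≤ t) (i : ℕ) (δ : Fin t → ℤ) :
    ∏ l, H a₁ a₂ (2 * i) (δ l) ≤ 1 / ((2 * (i : ℝ) + 1) * (4 * a₁)) := by
  refine (prod_H_le_two h ht (2 * i) δ).trans ?_
  have e0 := H_two_mul_sq_le h i (δ ⟨0, by omega⟩)
  have e1 := H_two_mul_sq_le h i (δ ⟨1, by omega⟩)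
  nlinarith [sq_nonneg (H a₁ a₂ (2 * i) (δ ⟨0, by omega⟩) - H a₁ a₂ (2 * i) (δ ⟨1, by omega⟩))]

/-- **The term bound**: `u k i · Π_l H (2i) (δ l) ≤ u k i / ((2i+1) 4a₁)`. -/
theorem term_le {a₁ a₂ : ℝ} (h : Adm a₁ a₂) (ht : 2 ≤ t) (i : ℕ) (δ : Fin t → ℤ) :
    u k i * ∏ l, H a₁ a₂ (2 * i) (δ l) ≤ u k i / ((2 * (i : ℝ) + 1) * (4 * a₁)) := by
  rw [div_eq_mul_one_div]
  exact mul_le_mul_of_nonneg_left (prod_H_le h ht i δ) (u_nonneg i)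

/-! ### The finite Green sums and the tail package -/

/-- The finite diagonal Green sum `Σ_{i<N} u k i · Π_l H a₁ a₂ (2i) (δ l)`. -/
def G0H (k : ℕ) (a₁ a₂ : ℝ) (N : ℕ) (δ : Fin t → ℤ) : ℝ := ∑ i ∈ range N, u k i * ∏ l, H a₁ a₂ (2 * i) (δ l)

/-- The finite adjacent Green sum `Σ_{i<N} c_i · Π_l H a₁ a₂ (2i) (δ l)`. -/
def G1H (k : ℕ) (a₁ a₂ : ℝ) (N : ℕ) (δ : Fin t → ℤ) : ℝ := ∑ i ∈ range N, cadj k i * ∏ l, H a₁ a₂ (2 * i) (δ l)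

/-- **A tail bound `T` for the Green sums at horizon `N`** (five-point law): nonnegative, and the partial sums of both
the diagonal and the adjacent Green series are below the finite sums to horizon `N` plus `T`, uniformly in `m`. -/
def TailBoundH (t k : ℕ) (a₁ a₂ : ℝ) (N : ℕ) (T : ℝ) : Prop :=
  0 ≤ T ∧ ∀ (m : ℕ) (δ : Fin t → ℤ),
    (∑ i ∈ range m, u k i * ∏ l, H a₁ a₂ (2 * i) (δ l) ≤ G0H k a₁ a₂ N δ + T) ∧
      (∑ i ∈ range m, cadj k i * ∏ l, H a₁ a₂ (2 * i) (δ l) ≤ G1H k a₁ a₂ N δ + T)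

/-- A generic uniform bound: nonnegative terms whose sum over any window `[N, m)` is at most `T`. -/
theorem sum_le_range_add {f : ℕ → ℝ} {T : ℝ} (hT : 0 ≤ T) (hf : ∀ i, 0 ≤ f i) {N : ℕ}
    (hwin : ∀ m, ∑ i ∈ Ico N m, f i ≤ T) (m : ℕ) : ∑ i ∈ range m, f i ≤ ∑ i ∈ range N, f i + T := by
  by_cases h : m ≤ N
  · calc ∑ i ∈ range m, f i ≤ ∑ i ∈ range N, f i :=
          sum_le_sum_of_subset_of_nonneg (range_mono h) fun i _ _ => hf i
      _ ≤ _ := le_add_of_nonneg_right hT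
  · have hNm : N ≤ m := by omega
    rw [← Finset.sum_range_add_sum_Ico _ hNm]
    exact add_le_add le_rfl (hwin m)

/-- **From a window bound on `u k i / ((2i+1) 4a₁)` to a tail bound.** -/
theorem tailBoundH_of_window {a₁ a₂ : ℝ} (h : Adm a₁ a₂) (hk : 2 ≤ k) (ht : 2 ≤ t) {N : ℕ} {T : ℝ} (hT : 0 ≤ T)
    (hwin : ∀ m, ∑ i ∈ Ico N m, u k i / ((2 * (i : ℝ) + 1) * (4 * a₁)) ≤ T) : TailBoundH t k a₁ a₂ N T := by
  refine ⟨hT, fun m δ => ⟨?_, ?_⟩⟩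
  · exact sum_le_range_add hT (fun i => mul_nonneg (u_nonneg i) (prod_H_nonneg h _ δ))
      (fun m => (sum_le_sum fun i _ => term_le h ht i δ).trans (hwin m)) m
  · exact sum_le_range_add hT (fun i => mul_nonneg (cadj_bounds hk i).1 (prod_H_nonneg h _ δ))
      (fun m => (sum_le_sum fun i _ => (mul_le_mul_of_nonneg_right (cadj_bounds hk i).2 (prod_H_nonneg h _ δ)).trans
        (term_le h ht i δ)).trans (hwin m)) m

/-! ### Two time axes: the exact telescoping -/

/-- `Mrec 1 m = 1` (one letter: one word of each length). -/
theorem Mrec_one (m : ℕ) : Mrec 1 m = 1 := by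
  show Mrec (0 + 1) m = 1
  rw [Mrec, Finset.sum_range_succ]
  have h0 : ∑ j ∈ range m, m.choose j ^ 2 * Mrec 0 (m - j) = 0 := by
    refine sum_eq_zero fun j hj => ?_
    have : m - j ≠ 0 := by have := mem_range.1 hj; omega
    rw [Mrec, if_neg this, mul_zero]
  rw [h0, Mrec, Nat.choose_self, Nat.sub_self, if_pos rfl]
  norm_num

/-- `Mrec 2 m = C(2m, m)` (Vandermonde). -/
theorem Mrec_two (m : ℕ) : Mrec 2 m = Nat.centralBinom m := by
  rw [show (2 : ℕ) = 1 + 1 from rfl, Mrec]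
  simp_rw [Mrec_one, mul_one]
  rw [Nat.sum_range_choose_sq, Nat.centralBinom]

/-- **`u 2 i = C(2i, i) / 4ⁱ`.** -/
theorem u_two_eq (i : ℕ) : u 2 i = (Nat.centralBinom i : ℝ) / 4 ^ i := by
  rw [u_eq_Mrec, Mrec_two]
  congr 1
  rw [pow_mul]; norm_num

/-- **The ratio of consecutive values**: `u 2 (i+1) · (2i+2) = u 2 i · (2i+1)`. -/
theorem u_two_succ (i : ℕ) : u 2 (i + 1) * (2 * (i : ℝ) + 2) = u 2 i * (2 * (i : ℝ) + 1) := by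
  rw [u_two_eq, u_two_eq]
  have h := Nat.succ_mul_centralBinom_succ i
  have h' : ((i : ℝ) + 1) * (Nat.centralBinom (i + 1) : ℝ) = 2 * (2 * (i : ℝ) + 1) * (Nat.centralBinom i : ℝ) := by
    exact_mod_cast h
  have h4 : (0 : ℝ) < 4 ^ i := by positivity
  rw [pow_succ, div_mul_eq_mul_div, div_mul_eq_mul_div, div_eq_div_iff (by positivity) (by positivity)]
  linear_combination (2 * (4 : ℝ) ^ i) * h'

/-- The telescoping step: `u 2 i / (2i+1) = (u 2 i - u 2 (i+1)) · (2i+2)/(2i+1) ≤ (u 2 i - u 2 (i+1)) (2N+2)/(2N+1)`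
for `i ≥ N`. -/
theorem u_two_div_le {N i : ℕ} (hNi : N ≤ i) :
    u 2 i / (2 * (i : ℝ) + 1) ≤ (u 2 i - u 2 (i + 1)) * ((2 * (N : ℝ) + 2) / (2 * (N : ℝ) + 1)) := by
  have hs := u_two_succ i
  have hi : (0 : ℝ) < 2 * (i : ℝ) + 1 := by positivity
  have hN : (0 : ℝ) < 2 * (N : ℝ) + 1 := by positivity
  have hNi' : (N : ℝ) ≤ i := by exact_mod_cast hNi
  have hu := u_nonneg (d := 2) i
  -- `u (i+1) = u i (2i+1)/(2i+2)`, so `u i - u (i+1) = u i / (2i+2)`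
  have hdiff : u 2 i - u 2 (i + 1) = u 2 i / (2 * (i : ℝ) + 2) := by
    rw [eq_div_iff (by positivity)]
    linear_combination -hs
  rw [hdiff, div_mul_div_comm, div_le_div_iff₀ hi (by positivity)]
  nlinarith [mul_nonneg hu (sub_nonneg.2 hNi')]

/-- **The window bound for two time axes**: `Σ_{i ∈ [N,m)} u 2 i / ((2i+1) 4a₁) ≤ u 2 N (2N+2) / ((2N+1) 4a₁)`. -/
theorem window_two {a₁ : ℝ} (ha : 0 < a₁) (N m : ℕ) :
    ∑ i ∈ Ico N m, u 2 i / ((2 * (i : ℝ) + 1) * (4 * a₁)) ≤ u 2 N * (2 * (N : ℝ) + 2) / ((2 * (N : ℝ) + 1) * (4 * a₁)) := by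
  have h4 : (0 : ℝ) < 4 * a₁ := by positivity
  have hr : (0 : ℝ) ≤ (2 * (N : ℝ) + 2) / (2 * (N : ℝ) + 1) := by positivity
  by_cases hNm : N ≤ m
  · have tel : ∑ i ∈ Ico N m, (u 2 i - u 2 (i + 1)) = u 2 N - u 2 m := by
      rw [Finset.sum_Ico_eq_sum_range]
      have : ∀ M : ℕ, ∑ j ∈ range M, (u 2 (N + j) - u 2 (N + j + 1)) = u 2 N - u 2 (N + M) := by
        intro M
        induction M with
        | zero => simp
        | succ M ih => rw [sum_range_succ, ih, show N + (M + 1) = N + M + 1 by ring]; ring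
      rw [this (m - N), Nat.add_sub_cancel' hNm]
    calc ∑ i ∈ Ico N m, u 2 i / ((2 * (i : ℝ) + 1) * (4 * a₁))
        = ∑ i ∈ Ico N m, u 2 i / (2 * (i : ℝ) + 1) * (1 / (4 * a₁)) :=
          sum_congr rfl fun i _ => by rw [div_mul_eq_div_mul_one_div]
      _ ≤ ∑ i ∈ Ico N m, (u 2 i - u 2 (i + 1)) * ((2 * (N : ℝ) + 2) / (2 * (N : ℝ) + 1)) * (1 / (4 * a₁)) :=
          sum_le_sum fun i hi => mul_le_mul_of_nonneg_right (u_two_div_le (mem_Ico.1 hi).1) (by positivity)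
      _ = (u 2 N - u 2 m) * ((2 * (N : ℝ) + 2) / (2 * (N : ℝ) + 1)) * (1 / (4 * a₁)) := by
          rw [← sum_mul, ← sum_mul, tel]
      _ ≤ u 2 N * ((2 * (N : ℝ) + 2) / (2 * (N : ℝ) + 1)) * (1 / (4 * a₁)) := by
          have := u_nonneg (d := 2) m
          gcongr
          linarith
      _ = _ := by field_simp
  · rw [Finset.Ico_eq_empty (by omega), sum_empty]
    exact div_nonneg (mul_nonneg (u_nonneg N) (by positivity)) (by positivity)

/-- **The tail bound for two time axes**: any `T ≥ u 2 N (2N+2) / ((2N+1) 4a₁)` is a tail bound (`t ≥ 2`). -/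
theorem tailBound_two {a₁ a₂ : ℝ} (h : Adm a₁ a₂) (ht : 2 ≤ t) (N : ℕ) {T : ℝ}
    (hT : u 2 N * (2 * (N : ℝ) + 2) / ((2 * (N : ℝ) + 1) * (4 * a₁)) ≤ T) : TailBoundH t 2 a₁ a₂ N T := by
  have h0 : 0 ≤ u 2 N * (2 * (N : ℝ) + 2) / ((2 * (N : ℝ) + 1) * (4 * a₁)) :=
    div_nonneg (mul_nonneg (u_nonneg N) (by positivity)) (by have := h.pos; positivity)
  exact tailBoundH_of_window h le_rfl ht (h0.trans hT) fun m => (window_two h.pos N m).trans hT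

/-! ### Three or more time axes: decay of the balanced probability -/

/-- **One step of the decay**: for `k ≥ 3`, `B k (q+1) · (q+2) ≤ B k q · (q+1)`. -/
theorem B_step1 (hk : 3 ≤ k) (q : ℕ) : B k (q + 1) * ((q : ℝ) + 2) ≤ B k q * ((q : ℝ) + 1) := by
  have hk0 : 0 < k := by omega
  have hB := B_pos hk0 q
  rw [B_succ hk0]
  -- the ratio product: the factors `j ≥ 2` are at most one, the first two are explicit
  have hden : (0 : ℝ) < (((q + 1) * k : ℕ) : ℝ) := by positivity
  have hfac : ∀ j ∈ range k, (((q * k + (j + 1) : ℕ) : ℝ) / (((q + 1) * k : ℕ) : ℝ)) ≤ 1 := by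
    intro j hj
    rw [div_le_one hden]
    have := mem_range.1 hj
    exact_mod_cast (by nlinarith : q * k + (j + 1) ≤ (q + 1) * k)
  have hfac0 : ∀ j ∈ range k, 0 ≤ (((q * k + (j + 1) : ℕ) : ℝ) / (((q + 1) * k : ℕ) : ℝ)) := fun j _ => by positivity
  -- split off `j = 0, 1`
  obtain ⟨k', rfl⟩ : ∃ k', k = k' + 2 := ⟨k - 2, by omega⟩
  rw [Finset.prod_range_succ', Finset.prod_range_succ']
  set R := ∏ j ∈ range k', (((q * (k' + 2) + (j + 1 + 1 + 1) : ℕ) : ℝ) / (((q + 1) * (k' + 2) : ℕ) : ℝ)) with hR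
  have hR1 : R ≤ 1 := prod_le_one (fun j hj => hfac0 (j + 1 + 1) (by have := mem_range.1 hj; exact mem_range.2 (by omega)))
    (fun j hj => hfac (j + 1 + 1) (by have := mem_range.1 hj; exact mem_range.2 (by omega)))
  have hR0 : 0 ≤ R := prod_nonneg fun j hj => hfac0 (j + 1 + 1) (by have := mem_range.1 hj; exact mem_range.2 (by omega))
  -- the polynomial inequality `(q+2)(qk+1)(qk+2) ≤ k²(q+1)³` for `k ≥ 3`
  set K : ℝ := ((k' : ℝ) + 2) with hK
  have hk'1 : (1 : ℝ) ≤ k' := by exact_mod_cast (show 1 ≤ k' by omega)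
  have hK3 : (3 : ℝ) ≤ K := by rw [hK]; linarith
  have hq0 : (0 : ℝ) ≤ q := Nat.cast_nonneg q
  have e1 : (((q * (k' + 2) + (0 + 1 + 1) : ℕ) : ℝ) / (((q + 1) * (k' + 2) : ℕ) : ℝ)) = ((q : ℝ) * K + 2) / (((q : ℝ) + 1) * K) := by
    rw [hK]; push_cast; ring_nf
  have e0 : (((q * (k' + 2) + (0 + 1) : ℕ) : ℝ) / (((q + 1) * (k' + 2) : ℕ) : ℝ)) = ((q : ℝ) * K + 1) / (((q : ℝ) + 1) * K) := by
    rw [hK]; push_cast; ring_nf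
  rw [e1, e0]
  have hKq : (0 : ℝ) < ((q : ℝ) + 1) * K := by positivity
  have hpoly : ((q : ℝ) + 2) * ((q : ℝ) * K + 1) * ((q : ℝ) * K + 2) ≤ K ^ 2 * ((q : ℝ) + 1) ^ 3 := by
    nlinarith [mul_nonneg hq0 hq0, mul_nonneg (mul_nonneg hq0 hq0) (by linarith : (0 : ℝ) ≤ K - 3),
      mul_nonneg hq0 (by linarith : (0 : ℝ) ≤ K - 3), sq_nonneg (K - 3)]
  have key : ((q : ℝ) * K + 2) / (((q : ℝ) + 1) * K) * (((q : ℝ) * K + 1) / (((q : ℝ) + 1) * K)) * ((q : ℝ) + 2) ≤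
      (q : ℝ) + 1 := by
    rw [div_mul_div_comm, div_mul_eq_mul_div, div_le_iff₀ (by positivity)]
    nlinarith [hpoly]
  calc B (k' + 2) q * (R * (((q : ℝ) * K + 2) / (((q : ℝ) + 1) * K)) * (((q : ℝ) * K + 1) / (((q : ℝ) + 1) * K))) *
        ((q : ℝ) + 2)
      = B (k' + 2) q * R * (((q : ℝ) * K + 2) / (((q : ℝ) + 1) * K) * (((q : ℝ) * K + 1) / (((q : ℝ) + 1) * K)) *
          ((q : ℝ) + 2)) := by ring
    _ ≤ B (k' + 2) q * 1 * ((q : ℝ) + 1) := by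
        refine mul_le_mul (mul_le_mul_of_nonneg_left hR1 hB.le) key (by positivity) (by positivity)
    _ = B (k' + 2) q * ((q : ℝ) + 1) := by ring

/-- **Decay**: `B k q · (q+1) ≤ B k q₀ · (q₀+1)` for `q ≥ q₀` (`k ≥ 3`). -/
theorem B_decay1 (hk : 3 ≤ k) {q₀ q : ℕ} (hq : q₀ ≤ q) : B k q * ((q : ℝ) + 1) ≤ B k q₀ * ((q₀ : ℝ) + 1) := by
  induction q, hq using Nat.le_induction with
  | base => exact le_rfl
  | succ q _ ih =>
    have := B_step1 hk q
    push_cast at this ⊢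
    rw [show (q : ℝ) + 1 + 1 = (q : ℝ) + 2 by ring]
    exact this.trans ih

/-- **The decay of the meeting probability for `k ≥ 3`**: `u k i · (i+1) ≤ k · B k q₀ · (q₀+1)` for `i ≥ q₀ k`. -/
theorem u_mul_le (hk : 3 ≤ k) {q₀ i : ℕ} (hi : q₀ * k ≤ i) :
    u k i * ((i : ℝ) + 1) ≤ (k : ℝ) * B k q₀ * ((q₀ : ℝ) + 1) := by
  have hk0 : 0 < k := by omega
  set q := i / k with hq
  have hq₀ : q₀ ≤ q := by rw [hq]; exact (Nat.le_div_iff_mul_le hk0).2 hi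
  have hqi : q * k ≤ i := by rw [hq]; exact Nat.div_mul_le_self i k
  have hiq : i + 1 ≤ (q + 1) * k := by
    rw [hq]; have := Nat.lt_div_mul_add hk0 (a := i); rw [Nat.add_mul, one_mul]; linarith [Nat.div_add_mod i k, Nat.mod_lt i hk0]
  have h1 : u k i ≤ B k q := (u_antitone hk0 hqi).trans (u_mul_le_B hk0 q)
  have h2 : B k q * ((q : ℝ) + 1) ≤ B k q₀ * ((q₀ : ℝ) + 1) := B_decay1 hk hq₀
  have hiq' : (i : ℝ) + 1 ≤ ((q : ℝ) + 1) * k := by exact_mod_cast hiq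
  have hB := (B_pos hk0 q).le
  calc u k i * ((i : ℝ) + 1) ≤ B k q * (((q : ℝ) + 1) * k) :=
        mul_le_mul h1 hiq' (by positivity) hB
    _ = (k : ℝ) * (B k q * ((q : ℝ) + 1)) := by ring
    _ ≤ (k : ℝ) * (B k q₀ * ((q₀ : ℝ) + 1)) := mul_le_mul_of_nonneg_left h2 (Nat.cast_nonneg k)
    _ = _ := by ring

/-- The tail constant for `k ≥ 3`: `Cu k q₀ = k · B k q₀ · (q₀ + 1)`. -/
def Cu (k q₀ : ℕ) : ℝ := (k : ℝ) * B k q₀ * ((q₀ : ℝ) + 1)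

/-- `Cu ≥ 0`. -/
theorem Cu_nonneg (hk : 0 < k) (q₀ : ℕ) : 0 ≤ Cu k q₀ := by
  unfold Cu; have := B_pos hk q₀; positivity

/-- **The window bound for `k ≥ 3`**: `Σ_{i ∈ [N,m)} u k i / ((2i+1) 4a₁) ≤ Cu k q₀ / (8 a₁ N)` for `N ≥ q₀ k`, `N ≥ 1`. -/
theorem window_three (hk : 3 ≤ k) {a₁ : ℝ} (ha : 0 < a₁) {q₀ N : ℕ} (hN : q₀ * k ≤ N) (hN1 : 1 ≤ N) (m : ℕ) :
    ∑ i ∈ Ico N m, u k i / ((2 * (i : ℝ) + 1) * (4 * a₁)) ≤ Cu k q₀ / (8 * a₁ * N) := by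
  have hk0 : 0 < k := by omega
  have hC := Cu_nonneg hk0 q₀
  -- each term is at most `Cu/(8a₁) · (1/i - 1/(i+1))`
  have hterm : ∀ i, N ≤ i → u k i / ((2 * (i : ℝ) + 1) * (4 * a₁)) ≤ Cu k q₀ / (8 * a₁) * (1 / (i : ℝ) - 1 / ((i : ℝ) + 1)) := by
    intro i hi
    have hi1 : (1 : ℝ) ≤ i := by exact_mod_cast hN1.trans hi
    have hu := u_mul_le hk (hN.trans hi)
    have hii : 1 / (i : ℝ) - 1 / ((i : ℝ) + 1) = 1 / ((i : ℝ) * ((i : ℝ) + 1)) := by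
      field_simp; ring
    rw [hii]
    have hC0 : 0 ≤ Cu k q₀ := hC
    have h1 : u k i ≤ Cu k q₀ / ((i : ℝ) + 1) := by rw [le_div_iff₀ (by positivity)]; exact hu
    calc u k i / ((2 * (i : ℝ) + 1) * (4 * a₁)) ≤ Cu k q₀ / ((i : ℝ) + 1) / ((2 * (i : ℝ) + 1) * (4 * a₁)) :=
          div_le_div_of_nonneg_right h1 (by positivity)
      _ ≤ Cu k q₀ / (8 * a₁) * (1 / ((i : ℝ) * ((i : ℝ) + 1))) := by
          rw [div_div, div_mul_div_comm, mul_one, div_le_div_iff₀ (by positivity) (by positivity)]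
          have h0 : 0 ≤ Cu k q₀ * a₁ * ((i : ℝ) + 1) := by positivity
          have e : Cu k q₀ * ((i + 1 : ℝ) * ((2 * (i : ℝ) + 1) * (4 * a₁))) - Cu k q₀ * (8 * a₁ * ((i : ℝ) * ((i : ℝ) + 1))) =
              4 * (Cu k q₀ * a₁ * ((i : ℝ) + 1)) := by ring
          linarith
  calc ∑ i ∈ Ico N m, u k i / ((2 * (i : ℝ) + 1) * (4 * a₁))
      ≤ ∑ i ∈ Ico N m, Cu k q₀ / (8 * a₁) * (1 / (i : ℝ) - 1 / ((i : ℝ) + 1)) :=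
        sum_le_sum fun i hi => hterm i (mem_Ico.1 hi).1
    _ = Cu k q₀ / (8 * a₁) * ∑ i ∈ Ico N m, (1 / (i : ℝ) - 1 / ((i : ℝ) + 1)) := by rw [mul_sum]
    _ ≤ Cu k q₀ / (8 * a₁) * (1 / (N : ℝ)) := mul_le_mul_of_nonneg_left (sum_Ico_telescope_le N m) (by positivity)
    _ = Cu k q₀ / (8 * a₁ * N) := by rw [mul_one_div, div_div]

/-- **The tail bound for `k ≥ 3` time axes**: any `T ≥ Cu k q₀ / (8 a₁ N)` is a tail bound (`N ≥ q₀ k`, `N ≥ 1`, `t ≥ 2`). -/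
theorem tailBound_three {a₁ a₂ : ℝ} (h : Adm a₁ a₂) (hk : 3 ≤ k) (ht : 2 ≤ t) {q₀ N : ℕ} (hN : q₀ * k ≤ N) (hN1 : 1 ≤ N)
    {T : ℝ} (hT : Cu k q₀ / (8 * a₁ * N) ≤ T) : TailBoundH t k a₁ a₂ N T := by
  have h0 : 0 ≤ Cu k q₀ / (8 * a₁ * N) := div_nonneg (Cu_nonneg (by omega) q₀) (by have := h.pos; positivity)
  exact tailBoundH_of_window h (by omega) ht (h0.trans hT) fun m => (window_three hk h.pos hN hN1 m).trans hT

end Summit.CriticalPhenomena.PercolationContinuityZ3.Theorems.Pcint.BSMX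

end
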